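import Summits.FinalStateConjecture.FinalStateConjecture.Theses.EternalPapapetrou
import Literature.Geometry.Lorentzian.SpacetimeLocalConvergence
import Literature.Geometry.Lorentzian.LeviCivitaProofs

/-!
# Birth skeleton (BC3) for crux `EternalPapapetrou.LaSalleTransfer`
# (stmt-FinalStateConjecture-10037, route `EternalPapapetrou`, rank 5)

Registered by the skeleton registrar (planner one-shot, 2026-08-17). Two NAMED stubs and the
kernel-checked composition `LaSalleTransfer_of` concluding the crux BY NAME
(`LaSalleTransfer_of_stubs` plugs the registered stubs in).

## The crux (FIXED; its three constants read back by `Iff.rfl` below)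

`LaSalleTransfer := FarZoneEternalPapapetrou → EternalStationaryExteriorIsKerr → CompleteScriSettlesC0`
— B = L → U → T, "LaSalle at null infinity". Informal content the prover must supply (route file):
(i) COMPACTNESS — late-time translates of the d.o.c. of an MGHD with complete `𝓘⁺` subconverge in
`Cᵏ_loc`, with eternal far charts, to Ricci-flat globally hyperbolic limits which are their own
d.o.c. ∪ black-hole region and inherit bounded geometry `‖Dᵐh‖ ≤ C/r`; (ii) limits are TWO-SIDED
NON-RADIATING at order `1/r`; (iii) L then U make every limit Kerr (`|a| ≤ M′`) or Minkowski;
(iv) isolation of the Kerr family among limits + monotone Bondi mass ⇒ parameters converge, `N` is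
finite, holes separate sublinearly, the charts exhaust `O` in `C⁰`.

## The cut: (i)+(ii) | (iii) = the composition | (iv)

The interface is the tree's pointed `Cᵏ_loc` subconvergence WITH FAR CHARTS
(`Spacetime.SubconvergesLocallyWithFarChartsTo`, `SpacetimeLocalConvergence.lean` — the definition
item filed for exactly this split of this crux) together with vocabulary that is VERBATIM route text:

* `IsEternalVacuum k M R C 𝓢 Φ` — the hypotheses of `U` minus the Killing field that `L` supplies:
  for the Levi-Civita connection (granted its existence) `𝓢` is Ricci-flat and globally hyperbolic,
  `Φ : Kerr.region 0 R → 𝓢` is an injective local diffeomorphism of the eternal cylinder with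
  bounded far geometry at order `k` (`HasBoundedFarGeometry`) and two-sided non-radiating below order
  `k` (`IsTwoSidedNonradiating`), and `𝓢` is a black-hole spacetime w.r.t. the far end or geodesically
  complete. `HasKerrOrMinkowskiDoc R 𝓢 Φ` — the conclusion of `U`. `IsStationaryNearInfinity` — the
  conclusion of `L`. Certificates: `farZoneEternalPapapetrou_iff`, `eternalStationaryExteriorIsKerr_iff`,
  `completeScriSettlesC0_iff` are `Iff.rfl`.
* `InDoc 𝒟 x` — the INTRINSIC domain of outer communications (Christodoulou: causal past of future
  null infinity, sojourn form): `x ∈ J⁺(ι X)` and `x ∈ J⁻(γ t)` for a future-complete normalised null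
  ray `γ` from the data (the rays of `RaysStayInClosure`), `t ≥ 0`. `IsLateDocSequence 𝒟 q` — base
  points in the d.o.c. leaving every compact set (`Filter.cocompact`: to `i⁺`, `𝓘⁺` or `i⁰`; never
  to a horizon point — those sit at finite position — nor to a singularity — not in `J⁻(𝓘⁺)`).
  `HasEternalLimitAlong k 𝒟 q M R C 𝓢 Φ` — `(𝒟, q n)` subconverges with far charts to `(𝓢, p)` at
  order `k` over the route's far background `farBackground M R`, `0 ≤ M`, `max (2M) 0 < R`, and the
  limit is an eternal vacuum object at order `k`. `SettlesC0 𝒟` — the matrix of `T`, verbatim.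
* STUB 1 `stub_lateLimitsEternal` ((i)+(ii); XL): for EVERY order `k`, every MGHD of admissible data
  with complete `𝓘⁺` and every late d.o.c. sequence `q`, an eternal vacuum ω-limit along `q` exists.
* STUB 2 `stub_kerrLimitsSettle` ((iv); L/XL): an MGHD of admissible data with complete `𝓘⁺` along
  whose every late d.o.c. sequence, at every order, some eternal vacuum ω-limit has Kerr-or-Minkowski
  d.o.c., settles down in `C⁰` (`SettlesC0`).
* COMPOSITION `LaSalleTransfer_of : Sig.stub_lateLimitsEternal → Sig.stub_kerrLimitsSettle →
  LaSalleTransfer` = step (iii), pure logic (20 lines): given `L = ⟨k_L, hL⟩`, `U = ⟨k_U, hU⟩` and an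
  MGHD, apply STUB 2; its hypothesis at order `k` is served by STUB 1 at order `k + (k_L + k_U)`, whose
  limit gets a timelike Killing field near infinity from `hL` and a Kerr-or-Minkowski d.o.c. from `hU`
  (the Levi-Civita instance is `PseudoRiemannianMetric.hasLeviCivita`, the `Kerr.Facts` instance is the
  binder of STUB 2's hypothesis), then is read at order `k` by `hasEternalLimitAlong_mono` (proved here:
  `LocalSubconvergence.mono` + `farChartsConverge_mono`).

Why this cut and not another. "T ∨ ∃ a non-Kerr eternal limit" as ONE stub is the crux minus the
rigidity (shredding, one stub). Cutting along "every limit is globally hyperbolic / black-hole-or-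
complete" as a `∀ limits` stub would be FALSE: the tree's subconvergence has no covering clause, so
open sub-spacetimes of a limit are limits (`SpacetimeLocalConvergenceRestrict.lean`) and are neither
globally hyperbolic nor Kerr — hence the global clauses sit INSIDE the existential `HasEternalLimitAlong`
(STUB 1 chooses the maximal limit) and STUB 2 only consumes limits carrying them. The order is `∀ k` in
both stubs because `L` and `U` quantify `∃ k`: the composition must serve unknown orders, and `∀ k` in
STUB 2's hypothesis is the WEAKEST form of STUB 2. Junk guards: the `refl` datum (a spacetime is its own
limit) is excluded by `cocompact` (a constant subsequence never leaves `J⁻` of itself); a flat limit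
near a hole is excluded by `Cᵏ` convergence of the components under injective local diffeomorphisms of
an exhaustion; `C < 0` is uninhabited; the reference mass `M` is not pinned (as in `L`, `U`).

## BC3 probes (registrar, 2026-08-17; `bc/probe_*.lean` in the seat folder — vocabulary copied
verbatim into `…Cruxes.LaSalleTransfer.BirthProbe`, skeleton theorems NOT present)

For each `S ∈ {Sig.stub_lateLimitsEternal, Sig.stub_kerrLimitsSettle}` and each target
`T ∈ {LaSalleTransfer, FinalStateConjecture}` the four cheap closers `first | exact? | simpa | aesop` ·
`simpa [S]` · `(unfold S; simpa)` · `intro h; simpa [S, T] using h` (maxHeartbeats 400000 each) ALL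
FAIL — 16/16 ("unsolved goals ⊢ LaSalleTransfer / ⊢ FinalStateConjecture" with "exact? could not
close", "aesop: failed to prove the goal after exhaustive search"; "Tactic `assumption` failed" resp.
whnf timeout at 400000 heartbeats; "Type mismatch after simplification"). No stub is cheaply the
crux or the summit.

Disproof used: none on file (`ledger crux ls stmt-FinalStateConjecture-10037`: no workfiles,
2026-08-17T02:40Z). Negatives honoured (`ledger negatives --problem FinalStateConjecture`: one entry,
`UniformPhotonSphereChannels`, unrelated): no stub re-words a refuted statement; no stub is a
conjunction-of-generics glue (both stubs and `T` are all-data statements, genericity lives in `G`).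
-/

-- the problem namespace `FinalStateConjecture.FinalStateConjecture` (single-conjunct summit) trips dupNamespace
set_option linter.dupNamespace false

noncomputable section

open scoped Manifold ContDiff Topology ENNReal
open Set Filter Function TopologicalSpace

namespace Summit.FinalStateConjecture.FinalStateConjecture.Cruxes.LaSalleTransfer.Birth

open Literature.Geometry.Lorentzian
open Summit.FinalStateConjecture.FinalStateConjecture.Theses.EternalPapapetrou
  (LaSalleTransfer FarZoneEternalPapapetrou EternalStationaryExteriorIsKerr CompleteScriSettlesC0)

/-! ### Vocabulary I: eternal far charts (verbatim the hypotheses / conclusions of `L` and `U`) -/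

section FarZone

variable (k : ℕ) (M R C : ℝ) (𝓢 : Spacetime.{0} 4) (Φ : Kerr.region (0 : ℝ) R → 𝓢.carrier)

/-- The **eternal far-zone reference background** of the route: the cylinder
`Kerr.region 0 R = ℝ_t × {|x| > R}`, the Schwarzschild form `Kerr.bilin M 0` (ingoing Kerr–Schild),
chart time `x⁰` and Euclidean radius `Kerr.radius 0`. Verbatim the `let B` of
`FarZoneEternalPapapetrou` / `EternalStationaryExteriorIsKerr`. [folklore] -/
def farBackground (M R : ℝ) : ModelBackground :=
  ⟨Kerr.region 0 R, Kerr.bilin M 0, fun x ↦ x 0, Kerr.radius 0⟩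

/-- **Bounded far geometry at order `k`** (`‖Dᵐ h‖ · r ≤ C` for `m ≤ k`, uniformly in `t`, where
`h = Φ^* g − g_M`): verbatim the first analytic hypothesis of `L`/`U`. [cite: arXiv210408222, §1] -/
def HasBoundedFarGeometry : Prop :=
  let B : ModelBackground := ⟨Kerr.region 0 R, Kerr.bilin M 0, fun x ↦ x 0, Kerr.radius 0⟩
  let h : E4 → E4 →L[ℝ] E4 →L[ℝ] ℝ := 𝓢.deviationExtend B Φ
  ∀ m ≤ k, ∀ x : Kerr.region (0 : ℝ) R, ‖iteratedFDeriv ℝ m h x.1‖ * Kerr.radius 0 x.1 ≤ C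

/-- **Two-sided non-radiating at order `1/r` below order `k`** (`r · ‖Dᵐ ∂₀ h‖ → 0` as `r → ∞`
uniformly in `t`, for `m < k`; no news out, none in, at all times): verbatim the second analytic
hypothesis of `L`/`U`. [cite: arXiv150404592, Thm 1.1] -/
def IsTwoSidedNonradiating : Prop :=
  let B : ModelBackground := ⟨Kerr.region 0 R, Kerr.bilin M 0, fun x ↦ x 0, Kerr.radius 0⟩
  let h : E4 → E4 →L[ℝ] E4 →L[ℝ] ℝ := 𝓢.deviationExtend B Φ
  let hₜ : E4 → E4 →L[ℝ] E4 →L[ℝ] ℝ := fun y ↦ fderiv ℝ h y (E4.basisVector 0)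
  ∀ m < k, ∀ δ > (0 : ℝ), ∃ R' : ℝ, ∀ x : Kerr.region (0 : ℝ) R,
    R' < Kerr.radius 0 x.1 → ‖iteratedFDeriv ℝ m hₜ x.1‖ * Kerr.radius 0 x.1 ≤ δ

/-- **Stationary near infinity** (a smooth timelike coordinate Killing field `T` of `G = g_M + h`
on some `{r > R₁}`): verbatim the conclusion of `L` = the Killing hypothesis of `U`.
[cite: doi:10.1063/1.1704792] -/
def IsStationaryNearInfinity : Prop :=
  let B : ModelBackground := ⟨Kerr.region 0 R, Kerr.bilin M 0, fun x ↦ x 0, Kerr.radius 0⟩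
  let h : E4 → E4 →L[ℝ] E4 →L[ℝ] ℝ := 𝓢.deviationExtend B Φ
  ∃ (R₁ : ℝ) (T : E4 → E4), R ≤ R₁ ∧ ContDiffOn ℝ (⊤ : ℕ∞) T {y | R₁ < Kerr.radius 0 y} ∧
    ∀ y : E4, R₁ < Kerr.radius 0 y → (h y + Kerr.bilin M 0 y) (T y) (T y) < 0 ∧
      ∀ v w : E4, (fderiv ℝ (fun z ↦ h z + Kerr.bilin M 0 z) y (T y)) v w +
        (h y + Kerr.bilin M 0 y) (fderiv ℝ T y v) w + (h y + Kerr.bilin M 0 y) v (fderiv ℝ T y w) = 0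

/-- **The domain of outer communications of the far end is a Kerr exterior, or the spacetime is
Minkowski**: verbatim the conclusion of `U` (`EternalStationaryExteriorIsKerr`). [cite: ChruscielCostaHeusler2012] -/
def HasKerrOrMinkowskiDoc [Kerr.Facts] : Prop :=
  (∃ (M' a : ℝ), 0 < M' ∧ |a| ≤ M' ∧ ∃ Ψ : Kerr.exterior M' a → 𝓢.carrier, Function.Injective Ψ ∧
      Set.range Ψ = 𝓢.docOfEnd (Set.range Φ) ∧
      PseudoRiemannianMetric.IsLocalIsometry
        (Kerr.smoothMetric M' a (Kerr.rPlus M' a)).toPseudoRiemannianMetric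
        𝓢.metric.toPseudoRiemannianMetric Ψ) ∨
  (∃ Ψ : Diffeomorph (𝓡 4) 𝓘(ℝ, E4) 𝓢.carrier E4 (⊤ : ℕ∞),
      PseudoRiemannianMetric.IsIsometry 𝓢.metric.toPseudoRiemannianMetric
        (Minkowski.metric.ofLE le_top : LorentzianMetric 𝓘(ℝ, E4) (⊤ : ℕ∞) E4).toPseudoRiemannianMetric Ψ)

/-- **Eternal vacuum object at order `k`** with far chart `Φ`: for the Levi-Civita connection
(granted its existence), `𝓢` is Ricci-flat and globally hyperbolic, `Φ` is an injective local
diffeomorphism of the eternal cylinder with bounded far geometry at order `k` and two-sided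
non-radiating below order `k`, and `𝓢` is a black-hole spacetime w.r.t. the far end or else
timelike- and null-geodesically complete — exactly the hypotheses of `U` other than the Killing
field that `L` supplies. [cite: KenigMerle2006] -/
def IsEternalVacuum : Prop :=
  ∀ [𝓢.metric.toPseudoRiemannianMetric.HasLeviCivita],
    𝓢.metric.toPseudoRiemannianMetric.IsRicciFlat ∧
    𝓢.metric.IsGloballyHyperbolic 𝓢.timeOrientation ∧
    IsLocalDiffeomorph 𝓘(ℝ, E4) (𝓡 4) (⊤ : ℕ∞) Φ ∧ Function.Injective Φ ∧
    HasBoundedFarGeometry k M R C 𝓢 Φ ∧ IsTwoSidedNonradiating k M R 𝓢 Φ ∧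
    ((𝓢.blackHoleRegionOfEnd (Set.range Φ)).Nonempty ∨
      (𝓢.metric.IsTimelikeGeodesicallyComplete ∧ 𝓢.metric.IsNullGeodesicallyComplete))

end FarZone

/-! ### Read-back certificates: the vocabulary IS the text of `L` and `U` -/

/-- `L` read back through the vocabulary (`Iff.rfl`). [folklore] -/
theorem farZoneEternalPapapetrou_iff :
    FarZoneEternalPapapetrou ↔
      ∃ k : ℕ, ∀ (M R C : ℝ), 0 ≤ M → max (2 * M) 0 < R → ∀ (𝓢 : Spacetime.{0} 4)
        [𝓢.metric.toPseudoRiemannianMetric.HasLeviCivita],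
        𝓢.metric.toPseudoRiemannianMetric.IsRicciFlat →
        ∀ (Φ : Kerr.region (0 : ℝ) R → 𝓢.carrier), IsLocalDiffeomorph 𝓘(ℝ, E4) (𝓡 4) (⊤ : ℕ∞) Φ →
        Function.Injective Φ → HasBoundedFarGeometry k M R C 𝓢 Φ → IsTwoSidedNonradiating k M R 𝓢 Φ →
        IsStationaryNearInfinity M R 𝓢 Φ :=
  Iff.rfl

/-- `U` read back through the vocabulary (`Iff.rfl`). [folklore] -/
theorem eternalStationaryExteriorIsKerr_iff :
    EternalStationaryExteriorIsKerr ↔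
      ∃ k : ℕ, ∀ (M R C : ℝ), 0 ≤ M → max (2 * M) 0 < R → ∀ (𝓢 : Spacetime.{0} 4)
        [𝓢.metric.toPseudoRiemannianMetric.HasLeviCivita] [Kerr.Facts],
        𝓢.metric.toPseudoRiemannianMetric.IsRicciFlat →
        𝓢.metric.IsGloballyHyperbolic 𝓢.timeOrientation →
        ∀ (Φ : Kerr.region (0 : ℝ) R → 𝓢.carrier), IsLocalDiffeomorph 𝓘(ℝ, E4) (𝓡 4) (⊤ : ℕ∞) Φ →
        Function.Injective Φ → HasBoundedFarGeometry k M R C 𝓢 Φ → IsTwoSidedNonradiating k M R 𝓢 Φ →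
        IsStationaryNearInfinity M R 𝓢 Φ →
        ((𝓢.blackHoleRegionOfEnd (Set.range Φ)).Nonempty ∨
          (𝓢.metric.IsTimelikeGeodesicallyComplete ∧ 𝓢.metric.IsNullGeodesicallyComplete)) →
        HasKerrOrMinkowskiDoc R 𝓢 Φ :=
  Iff.rfl

/-! ### Vocabulary II: late-time sequences in the domain of outer communications, ω-limits, settling -/

section PerDevelopment

variable {X : Type} [TopologicalSpace X] [ChartedSpace E3 X] [IsManifold (𝓡 3) ∞ X]
  [ConnectedSpace X] {D : InitialDataSet (𝓡 3) X}

/-- **`𝒟` settles down in `C⁰`** (one development): VERBATIM the matrix of the route's target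
`CompleteScriSettlesC0` — an `N`-hole `FinalStateDecomposition` in `C⁰` of the self-determined
exterior `O = exteriorOf 𝒟 d.charted` with `RaysStayInClosure`, honest exhaustive charts and
future-oriented chart time. [cite: DafermosLuk2017, Conjecture 1] -/
def SettlesC0 (𝒟 : VacuumCauchyDevelopment D) : Prop :=
  ∃ (O : Set 𝒟.carrier) (d : FinalStateDecomposition 𝒟.toSpacetime O 0),
    O = Summit.FinalStateConjecture.exteriorOf 𝒟.toCauchyDevelopment d.charted ∧
      Summit.FinalStateConjecture.RaysStayInClosure 𝒟.toCauchyDevelopment O ∧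
        Summit.FinalStateConjecture.HasExhaustiveCharts d ∧ Summit.FinalStateConjecture.IsFutureOriented d

/-- **`x` lies in the domain of outer communications of `𝒟`, intrinsically** (Christodoulou: the
d.o.c. is the causal past of future null infinity; sojourn form, no conformal boundary): for the
Levi-Civita connection granted its existence, `x ∈ J⁺(ι X)` and `x ∈ J⁻(γ t)` for some
future-complete normalised null ray `γ` from the data (`IsNormalisedNullRayFrom`, affine domain
unbounded above — the rays of `RaysStayInClosure`) and some parameter `t ≥ 0`.
[cite: Christodoulou2008, Prologue p. 6] -/
def InDoc (𝒟 : VacuumCauchyDevelopment D) (x : 𝒟.carrier) : Prop :=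
  ∀ [𝒟.metric.HasLeviCivita],
    x ∈ 𝒟.metric.causalFuture 𝒟.timeOrientation (Set.range 𝒟.embed) ∧
      ∃ (p : X) (γ : ℝ → 𝒟.carrier) (dom : Set ℝ),
        𝒟.metric.IsNormalisedNullRayFrom 𝒟.timeOrientation 𝒟.embed 𝒟.normal p γ dom ∧
          ¬ BddAbove dom ∧ ∃ t ∈ dom, 0 ≤ t ∧ x ∈ 𝒟.metric.causalPast 𝒟.timeOrientation {γ t}

/-- **A late-time sequence of the domain of outer communications**: base points `q n` in the
intrinsic d.o.c. (`InDoc`) which leave every compact subset of the development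
(`Filter.cocompact`: they run off to `i⁺`, `𝓘⁺` or `i⁰` — never to a horizon point or a
singularity, which are at finite position resp. outside `J⁻(𝓘⁺)`). The index set of the LaSalle
ω-limit analysis. [cite: Hale1980, Ch. I §8] -/
def IsLateDocSequence (𝒟 : VacuumCauchyDevelopment D) (q : ℕ → 𝒟.carrier) : Prop :=
  Tendsto q atTop (cocompact 𝒟.carrier) ∧ ∀ n, InDoc 𝒟 (q n)

/-- **`(𝓢, Φ)` is an eternal vacuum ω-limit of `𝒟` along `q` at order `k`** (reference mass
`M ≥ 0`, far radius `R > max(2M, 0)`, geometry constant `C`): the pointed spacetimes `(𝒟, q n)`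
subconverge in the pointed `Cᵏ_loc` (Cheeger–Gromov) sense WITH FAR CHARTS
(`Spacetime.SubconvergesLocallyWithFarChartsTo`, the definition item filed for this crux: comparison
embeddings of an exhaustion of `𝓢` into `𝒟`, `Cᵏ` convergence of the metric components on compacts,
far charts `Φₙ` of `𝒟` converging through the embeddings to `Φ`) to `(𝓢, p)`, and the limit is an
eternal vacuum object at order `k` (`IsEternalVacuum`). [cite: Petersen2006, Ch. 10 §3.2] -/
def HasEternalLimitAlong (k : ℕ) (𝒟 : VacuumCauchyDevelopment D) (q : ℕ → 𝒟.carrier)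
    (M R C : ℝ) (𝓢 : Spacetime.{0} 4) (Φ : Kerr.region (0 : ℝ) R → 𝓢.carrier) : Prop :=
  0 ≤ M ∧ max (2 * M) 0 < R ∧
    (∃ (p : 𝓢.carrier) (Φₙ : ℕ → Kerr.region (0 : ℝ) R → 𝒟.carrier),
      Spacetime.SubconvergesLocallyWithFarChartsTo (fun _ : ℕ ↦ 𝒟.toSpacetime) q 𝓢 p k
        (farBackground M R) Φₙ Φ) ∧
    IsEternalVacuum k M R C 𝓢 Φ

end PerDevelopment

/-- Read-back: the route's target `T = CompleteScriSettlesC0` IS "every MGHD of admissible data with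
complete `𝓘⁺` settles in `C⁰`" (`Iff.rfl`). [folklore] -/
theorem completeScriSettlesC0_iff :
    CompleteScriSettlesC0 ↔
      ∀ (X : Type) [TopologicalSpace X] [ChartedSpace E3 X] [IsManifold (𝓡 3) ∞ X] [T2Space X]
        [SecondCountableTopology X] [ConnectedSpace X], ∀ D ∈ admissibleVacuumData X,
        ∀ 𝒟 : VacuumCauchyDevelopment D, 𝒟.IsMaximal →
          Summit.FinalStateConjecture.HasCompleteNullInfinity 𝒟.toCauchyDevelopment → SettlesC0 𝒟 :=
  Iff.rfl

/-! ### Monotonicity in the order (used by the composition to serve every order from `L`, `U`) -/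

section Mono

variable {X : Type} [TopologicalSpace X] [ChartedSpace E3 X] [IsManifold (𝓡 3) ∞ X]
  [ConnectedSpace X] {D : InitialDataSet (𝓡 3) X}

/-- Far charts converging in `Cᵏ` converge in `Cᵏ'` for `k' ≤ k`, along the same datum
(`supCkENorm` is monotone in the order). [folklore] -/
theorem farChartsConverge_mono {𝓢ₙ : ℕ → Spacetime.{0} 4} {pₙ : ∀ n, (𝓢ₙ n).carrier}
    {𝓢 : Spacetime.{0} 4} {p : 𝓢.carrier} {k k' : ℕ}
    {Dₛ : Spacetime.LocalSubconvergence 𝓢ₙ pₙ 𝓢 p k} {B : ModelBackground}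
    {Φₙ : ∀ n, B.domain → (𝓢ₙ n).carrier} {Φ : B.domain → 𝓢.carrier}
    (h : Dₛ.FarChartsConverge B Φₙ Φ) (hk : k' ≤ k) : (Dₛ.mono hk).FarChartsConverge B Φₙ Φ where
  eventually_embed_comp_eq := h.eventually_embed_comp_eq
  tendsto_supCkENorm_deviationExtend K hK hKB :=
    tendsto_of_tendsto_of_tendsto_of_le_of_le tendsto_const_nhds
      (h.tendsto_supCkENorm_deviationExtend K hK hKB) (fun _ ↦ zero_le)
      fun _ ↦ supCkENorm_mono_right _ hk _

/-- An eternal vacuum object at order `k` is one at every order `k' ≤ k`. [folklore] -/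
theorem isEternalVacuum_mono {k k' : ℕ} {M R C : ℝ} {𝓢 : Spacetime.{0} 4}
    {Φ : Kerr.region (0 : ℝ) R → 𝓢.carrier} (h : IsEternalVacuum k M R C 𝓢 Φ) (hk : k' ≤ k) :
    IsEternalVacuum k' M R C 𝓢 Φ := by
  intro _inst
  obtain ⟨hRic, hGH, hdiff, hinj, hbd, hnr, hbh⟩ := h
  exact ⟨hRic, hGH, hdiff, hinj, fun m hm ↦ hbd m (hm.trans hk),
    fun m hm ↦ hnr m (lt_of_lt_of_le hm hk), hbh⟩

/-- An eternal vacuum ω-limit along `q` at order `k` is one at every order `k' ≤ k` (same limit,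
same far charts, same comparison maps). [folklore] -/
theorem hasEternalLimitAlong_mono {k k' : ℕ} {𝒟 : VacuumCauchyDevelopment D} {q : ℕ → 𝒟.carrier}
    {M R C : ℝ} {𝓢 : Spacetime.{0} 4} {Φ : Kerr.region (0 : ℝ) R → 𝓢.carrier}
    (h : HasEternalLimitAlong k 𝒟 q M R C 𝓢 Φ) (hk : k' ≤ k) :
    HasEternalLimitAlong k' 𝒟 q M R C 𝓢 Φ := by
  obtain ⟨hM, hR, ⟨p, Φₙ, Dₛ, hfar⟩, hE⟩ := h
  exact ⟨hM, hR, ⟨p, Φₙ, Dₛ.mono hk, farChartsConverge_mono hfar hk⟩, isEternalVacuum_mono hE hk⟩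

end Mono

/-! ### The stub SIGNATURES (`Sig.stub_<name>` = verbatim the statement of `theorem stub_<name>`) -/

/-- Signature of STUB 1 (late-time ω-limits exist and are eternal vacua; see
`stub_lateLimitsEternal`). -/
def Sig.stub_lateLimitsEternal : Prop :=
  ∀ (k : ℕ) (X : Type) [TopologicalSpace X] [ChartedSpace E3 X] [IsManifold (𝓡 3) ∞ X] [T2Space X]
    [SecondCountableTopology X] [ConnectedSpace X], ∀ D ∈ admissibleVacuumData X,
    ∀ 𝒟 : VacuumCauchyDevelopment D, 𝒟.IsMaximal →
      Summit.FinalStateConjecture.HasCompleteNullInfinity 𝒟.toCauchyDevelopment →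
      ∀ q : ℕ → 𝒟.carrier, IsLateDocSequence 𝒟 q →
        ∃ (M R C : ℝ) (𝓢 : Spacetime.{0} 4) (Φ : Kerr.region (0 : ℝ) R → 𝓢.carrier),
          HasEternalLimitAlong k 𝒟 q M R C 𝓢 Φ

/-- Signature of STUB 2 (Kerr-or-Minkowski ω-limits along every late sequence force `C⁰`
settling; see `stub_kerrLimitsSettle`). -/
def Sig.stub_kerrLimitsSettle : Prop :=
  ∀ (X : Type) [TopologicalSpace X] [ChartedSpace E3 X] [IsManifold (𝓡 3) ∞ X] [T2Space X]
    [SecondCountableTopology X] [ConnectedSpace X], ∀ D ∈ admissibleVacuumData X,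
    ∀ 𝒟 : VacuumCauchyDevelopment D, 𝒟.IsMaximal →
      Summit.FinalStateConjecture.HasCompleteNullInfinity 𝒟.toCauchyDevelopment →
      (∀ (k : ℕ) [Kerr.Facts] (q : ℕ → 𝒟.carrier), IsLateDocSequence 𝒟 q →
        ∃ (M R C : ℝ) (𝓢 : Spacetime.{0} 4) (Φ : Kerr.region (0 : ℝ) R → 𝓢.carrier),
          HasEternalLimitAlong k 𝒟 q M R C 𝓢 Φ ∧ HasKerrOrMinkowskiDoc R 𝓢 Φ) →
      SettlesC0 𝒟

/-! ### The registered stubs (the ONLY sorries of this file) -/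

/-- **STUB 1 — late-time ω-limits of the domain of outer communications exist and are eternal,
two-sided non-radiating vacua** (content (i)+(ii) of the crux; the route's foreseen children B1–B2).
For every order `k`, every connected Hausdorff second-countable `X`, every admissible datum `D`, every
maximal vacuum Cauchy development `𝒟` of `D` with complete future null infinity, and every sequence of
base points `q n` in the intrinsic d.o.c. leaving every compact set, the pointed spacetimes `(𝒟, q n)`
subconverge in the pointed `Cᵏ_loc` sense with far charts to an eternal vacuum object
`(𝓢, Φ : Kerr.region 0 R → 𝓢)` of order `k`: Ricci-flat, globally hyperbolic, far chart an injective
local diffeomorphism with `‖Dᵐ(Φ^*g − g_M)‖·r ≤ C` (`m ≤ k`) and `r‖Dᵐ∂₀(Φ^*g − g_M)‖ → 0` uniformly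
in `t` (`m < k`), black-hole w.r.t. the far end or geodesically complete. Plan: (a) a-priori tameness of
the late d.o.c. in an era/harmonic gauge up to and across `𝓗⁺` (THE unknown: orbital stability in the
large); (b) extraction = the tree's Cheeger–Gromov producers
(`Spacetime.exists_nearMinkowskiChart_subconvergesLocallyTo`, `TameChartCompactness.lean`;
`Spacetime.exists_omegaLimit_timeTranslates_of_lateChart`, `FutureChartOmegaLimit.lean`; the
`SpacetimeLocalConvergence*.lean` algebra: restriction, diagonal, translation, isometry invariance) on
an exhaustion, keeping the MAXIMAL limit; (c) vacuum passes to `C²` limits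
(`NearMinkowskiChart.isRicciFlat_spacetime_of_tendsto`, `VacuumLocalLimit.lean`, proved); (d) far charts
= translates of the asymptotically flat far chart of `𝒟`, bounds inherited
(`FarChartsConverge.norm_iteratedFDeriv_mul_le`, proved); two-sided non-radiation of LIMITS from the
finite total Bondi flux to the future (`BondiFoliation.bondiMass_antitone`, `finalBondiMass_nonneg`,
`BondiMass.lean`; a Barbalat/LaSalle step turns integrated flux into news → 0 along translates) and from
asymptotic flatness of the data to the past (no incoming radiation at late advanced time); (e) the
maximal limit is globally hyperbolic and contains a horizon collar (black-hole alternative) unless the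
base points recede from every hole (Minkowski, complete). Why it might fail: uniform `Cᵏ` bounds of a
LARGE-DATA d.o.c. up to `𝓗⁺` are known only near Kerr (arXiv:2104.08222, arXiv:2104.11857,
arXiv:2205.14808) and weak (Burnett) limits may leave vacuum (arXiv:1907.10743) — excluded only by those
bounds; an extremal or asymptotically extremal end state (KehleUnger2025) has no `Cᵏ_loc` compactness
across its horizon for `k ≥ 2` (Aretakis instability) — the crux's own B-only falsifier, now located
in THIS stub; order-`1/r` non-radiation UNIFORM in `t` is stronger than finite flux. Size XL
(open-problem strength). Sources: KenigMerle2006; doi:10.4310/cjm.2013.v1.n1.a3; Petersen2006 Ch. 10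
§3.2; Anderson2004; arXiv:1907.10743; arXiv:2104.08222; arXiv:1710.01722 §1.2.1; Christodoulou2008. -/
theorem stub_lateLimitsEternal :
    ∀ (k : ℕ) (X : Type) [TopologicalSpace X] [ChartedSpace E3 X] [IsManifold (𝓡 3) ∞ X] [T2Space X]
      [SecondCountableTopology X] [ConnectedSpace X], ∀ D ∈ admissibleVacuumData X,
      ∀ 𝒟 : VacuumCauchyDevelopment D, 𝒟.IsMaximal →
        Summit.FinalStateConjecture.HasCompleteNullInfinity 𝒟.toCauchyDevelopment →
        ∀ q : ℕ → 𝒟.carrier, IsLateDocSequence 𝒟 q →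
          ∃ (M R C : ℝ) (𝓢 : Spacetime.{0} 4) (Φ : Kerr.region (0 : ℝ) R → 𝓢.carrier),
            HasEternalLimitAlong k 𝒟 q M R C 𝓢 Φ := by
  sorry

/-- **STUB 2 — Kerr-or-Minkowski ω-limits along every late sequence force `C⁰` settling**
(content (iv) of the crux; the route's foreseen child B3). For every admissible datum and every maximal
vacuum Cauchy development `𝒟` with complete future null infinity: IF (granted the Kerr–Schild facts) for
every order `k` and every late d.o.c. sequence `q` some eternal vacuum ω-limit `(𝓢, Φ)` of `(𝒟, q n)` at
order `k` has domain of outer communications of its far end isometric to ONE Kerr exterior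
`Kerr.exterior M′ a`, `0 < M′`, `|a| ≤ M′`, or is globally Minkowski (`HasKerrOrMinkowskiDoc`, the
conclusion of `U` verbatim), THEN `𝒟` settles down in `C⁰`: an `N`-hole `FinalStateDecomposition … O 0`
with `O = exteriorOf 𝒟 d.charted`, `RaysStayInClosure`, `HasExhaustiveCharts`, `IsFutureOriented`
(`SettlesC0`, the matrix of `T` verbatim). Plan (LaSalle ⇒ convergence): the hypothesis says every
late region of the d.o.c. is, on compacts of every size and in every `Cᵏ`, a piece of one boosted
Kerr black hole (with a horizon collar) or of Minkowski space; (a) holes := classes of late sequences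
with Kerr limits at bounded mutual distance; `N < ∞` from the ADM/Bondi mass budget, `M′ > 0` of each
limit and asymptotic flatness of the data (no holes form arbitrarily far out / arbitrarily late);
(b) parameters `(Mᵢ, aᵢ, Λᵢ)` are constant on each hole's ω-limit set: ω-limit sets of a curve are
connected (Hale 1980, Ch. I §8, `LateTimeOmegaLimitSet.lean`), the Kerr family is isolated among the
limits, mass is pinned by the monotone Bondi mass (`bondiMass_antitone`), spin and boost by continuity
+ isolation (modulation); (c) late charts `Ψᵢ` on boosted Kerr exteriors and a flat chart `Ψ₀` glued
from ω-limit charts along a late foliation; `C⁰` convergence on truncated slabs of every radius from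
`Cᵏ_loc` convergence + (b); sublinear separation from single-component limits; the exhaustion clause
from the fact that every late point of `O` lies on a late d.o.c. sequence and the horizon collar of the
black-hole limits; rays in closure and future orientation from convergence of the causal structure
(`C¹` suffices). Why it might fail: DRIFT — `(M, a, boost)` may wander along a connected ω-limit set of
Kerrs (no signed angular- or linear-momentum flux at this level; the crux's named risk); `N` finite and
"no late far-out collapse" use more than the hypothesis gives pointwise; `HasExhaustiveCharts` must reach
`𝓗⁺` while late sequences approach it only inside `J⁻(𝓘⁺)`; extremal limits (`|a| = M′` allowed by
`U`) have degenerate collars. Size L/XL. Sources: KenigMerle2006; doi:10.4310/cjm.2013.v1.n1.a3;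
Hale1980 Ch. I §8; Moschidis2016; DafermosHolzegelRodnianskiTaylor2021 (arXiv:2104.08222 §1);
KlainermanSzeftel2023; arXiv:1710.01722 Conjecture 1; Christodoulou2008 Prologue p. 6. -/
theorem stub_kerrLimitsSettle :
    ∀ (X : Type) [TopologicalSpace X] [ChartedSpace E3 X] [IsManifold (𝓡 3) ∞ X] [T2Space X]
      [SecondCountableTopology X] [ConnectedSpace X], ∀ D ∈ admissibleVacuumData X,
      ∀ 𝒟 : VacuumCauchyDevelopment D, 𝒟.IsMaximal →
        Summit.FinalStateConjecture.HasCompleteNullInfinity 𝒟.toCauchyDevelopment →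
        (∀ (k : ℕ) [Kerr.Facts] (q : ℕ → 𝒟.carrier), IsLateDocSequence 𝒟 q →
          ∃ (M R C : ℝ) (𝓢 : Spacetime.{0} 4) (Φ : Kerr.region (0 : ℝ) R → 𝓢.carrier),
            HasEternalLimitAlong k 𝒟 q M R C 𝓢 Φ ∧ HasKerrOrMinkowskiDoc R 𝓢 Φ) →
        SettlesC0 𝒟 := by
  sorry

/-! ### The composition: the skeleton concludes the crux BY NAME -/

/-- **The crux from the two stubs** = step (iii) of the crux, pure logic: for an MGHD with complete
`𝓘⁺`, feed STUB 2; its hypothesis at order `k` is served by STUB 1 at order `k + (k_L + k_U)`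
(the orders of `L` and `U`), whose eternal vacuum limit is made stationary near infinity by `L`
and Kerr-or-Minkowski by `U`, then read at order `k` by monotonicity. -/
theorem LaSalleTransfer_of :
    Sig.stub_lateLimitsEternal → Sig.stub_kerrLimitsSettle → LaSalleTransfer := by
  intro hA hB hL hU X _ _ _ _ _ _ D hD 𝒟 hmax hscri
  obtain ⟨kL, hL⟩ := hL
  obtain ⟨kU, hU⟩ := hU
  refine hB X D hD 𝒟 hmax hscri fun k ↦ ?_
  intro _instKF q hq
  obtain ⟨M, R, C, 𝓢, Φ, hlim⟩ := hA (k + (kL + kU)) X D hD 𝒟 hmax hscri q hq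
  refine ⟨M, R, C, 𝓢, Φ, hasEternalLimitAlong_mono hlim (Nat.le_add_right k _), ?_⟩
  obtain ⟨hM, hR, -, hE⟩ := hlim
  haveI := 𝓢.metric.toPseudoRiemannianMetric.hasLeviCivita
  obtain ⟨hRic, hGH, hdiff, hinj, hbd, hnr, hbh⟩ := hE
  have hKilling : IsStationaryNearInfinity M R 𝓢 Φ :=
    hL M R C hM hR 𝓢 hRic Φ hdiff hinj (fun m hm ↦ hbd m (by omega)) (fun m hm ↦ hnr m (by omega))
  exact hU M R C hM hR 𝓢 hRic hGH Φ hdiff hinj (fun m hm ↦ hbd m (by omega))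
    (fun m hm ↦ hnr m (by omega)) hKilling hbh

/-- **… with the registered stubs plugged in**: the skeleton proves the crux by name modulo exactly
the two `sorry`s of `stub_lateLimitsEternal` and `stub_kerrLimitsSettle`. -/
theorem LaSalleTransfer_of_stubs : LaSalleTransfer :=
  LaSalleTransfer_of stub_lateLimitsEternal stub_kerrLimitsSettle

end Summit.FinalStateConjecture.FinalStateConjecture.Cruxes.LaSalleTransfer.Birth

end
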